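import Summits.Ventures.Crystal3D.Bulk.ConvexPositionGluing
import HarnessLib

/-!
# Signs of the vertices of a convex spherical polygon against a great circle: unimodality, the
# fan lemma, the sign block, rotations — bricks (S5) of (d3) «one rattler per p-hexagon»

HONEST FRAMING. Part of the venture `Summits/Ventures/Crystal3D` (cell `pub-crystal3d`, phase 2;
seat typer-bulk-2), generic and configuration-free; nothing here mentions GAP(1.26). Setting: a
periodic sequence `w` of vectors of `ℝ³` (period `n ≥ 3`) in window convex position
`∀ i < j < k < i+n, 0 < orient3 (w i) (w j) (w k)` (cf. `Bulk/ConvexPositionGluing.lean`,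
`Bulk/SphPolygonCap.lean`), and a vector `ν` — the pole of a cutting great circle `ν⊥`; the
vertex signs are `⟪w i, ν⟫`. In the perimeter proof of the census row (d3)
(`phase2/theory1/HEX-PERIMETER.md`, plan `HOME/lean/hexper/README.md`) the face is clipped by
the two common tangents of the two rattler caps (`Bulk/SphPolygonCut.lean`); this file supplies
the combinatorics of the vertex signs:

* **unimodality** `not_alternating_signs` — at four cyclically increasing indices the signs
  cannot read `(> 0, ≤ 0, > 0, ≤ 0)` (one Cramer expansion `orient3_expand`: the two chords
  would cross);
* **fan lemma** `exists_fan_triangle` — every point of the closed polygonal cone lies in the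
  closed cone of a fan triangle `(w 0, w i, w (i+1))`; consequences `exists_inner_pos_vertex`
  (a cone point on the positive side forces a positive vertex), `exists_edge_of_inner_zero` (a
  cone point ON the circle, all vertices `≥ 0`, base vertex `> 0` ⇒ it lies on an edge whose
  weighted endpoints are on the circle), `eq_zero_of_three_on_circle`;
* **sign block** `exists_sign_block` — with a strictly negative and a strictly positive vertex,
  after a rotation the strictly positive vertices form an initial block;
* **rotations** `shift_periodic`, `shift_convex`, `sum_period_shift`, `shift_edges`,
  `shift_vertices`.
-/

noncomputable section

namespace Summit.Ventures.Crystal3D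

open Literature.Geometry.DiscreteGeometry Real InnerProductGeometry Finset
open scoped InnerProductSpace RealInnerProductSpace

section Polygon

variable {n : ℕ} {w : ℕ → EuclideanSpace ℝ (Fin 3)} (hn : 3 ≤ n) (hper : ∀ i, w (i + n) = w i)
  (hcx : ∀ i j k, i < j → j < k → k < i + n → 0 < orient3 (w i) (w j) (w k))
include hn hper hcx

/-! ## Part B. Unimodality of the signs along the cycle -/

omit hn hper in
/-- **Unimodality.** For cyclically increasing indices `a < b < c < d < a + n` the signs
`⟪w ·, ν⟫` cannot read `(> 0, ≤ 0, > 0, ≤ 0)`: the chords `w a w c` and `w b w d` of a convex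
polygon cross (Cramer: `o(a,b,c) w d = o(b,c,d) w a − o(a,c,d) w b + o(a,b,d) w c`). -/
theorem not_alternating_signs (ν : EuclideanSpace ℝ (Fin 3)) {a b c d : ℕ} (hab : a < b)
    (hbc : b < c) (hcd : c < d)
    (hda : d < a + n) (ha : 0 < ⟪w a, ν⟫) (hb : ⟪w b, ν⟫ ≤ 0) (hc : 0 < ⟪w c, ν⟫)
    (hd : ⟪w d, ν⟫ ≤ 0) : False := by
  have habc := hcx a b c hab hbc (by omega)
  have hbcd := hcx b c d hbc hcd (by omega)
  have hacd := hcx a c d (by omega) hcd hda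
  have habd := hcx a b d hab (by omega) hda
  have hexp := orient3_expand (w a) (w b) (w c) (w d)
  -- coefficients: `o(d,b,c) = o(b,c,d)`, `o(a,d,c) = −o(a,c,d)`
  rw [show orient3 (w d) (w b) (w c) = orient3 (w b) (w c) (w d) from orient3_cyclic _ _ _,
    show orient3 (w a) (w d) (w c) = -orient3 (w a) (w c) (w d) from orient3_swap_right _ _ _]
    at hexp
  have h := congrArg (fun v => ⟪v, ν⟫) hexp
  simp only [inner_add_left, real_inner_smul_left, inner_neg_left, neg_smul] at h
  -- `o(a,b,c) σ_d = o(b,c,d) σ_a − o(a,c,d) σ_b + o(a,b,d) σ_c`: left ≤ 0 < right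
  nlinarith [mul_nonpos_of_nonneg_of_nonpos habc.le hd, mul_pos hbcd ha,
    mul_nonpos_of_nonneg_of_nonpos hacd.le hb, mul_pos habd hc]

/-! ## Part C. The fan lemma and its consequences -/

omit hper in
/-- **Fan lemma.** A point `y` of the closed polygonal cone (`0 ≤ orient3 (w i) (w (i+1)) y`
for `i < n`, with `w n = w 0`) lies in the closed cone of a fan triangle `(w 0, w i, w (i+1))`,
`1 ≤ i ≤ n − 2`: `y = a w 0 + b w i + c w (i+1)` with `a, b, c ≥ 0`. -/
theorem exists_fan_triangle (hw0 : w n = w 0) {y : EuclideanSpace ℝ (Fin 3)}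
    (hy : ∀ i, i < n → 0 ≤ orient3 (w i) (w (i + 1)) y) :
    ∃ i, 1 ≤ i ∧ i + 2 ≤ n ∧ ∃ a b c : ℝ, 0 ≤ a ∧ 0 ≤ b ∧ 0 ≤ c ∧
      y = a • w 0 + b • w i + c • w (i + 1) := by
  classical
  -- the last index `i ∈ [1, n−2]` with `o(w 0, w i, y) ≥ 0`
  obtain ⟨S, hS⟩ : ∃ S : Finset ℕ, S = (Icc 1 (n - 2)).filter fun i => 0 ≤ orient3 (w 0) (w i) y :=
    ⟨_, rfl⟩
  have h1S : 1 ∈ S := by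
    rw [hS, mem_filter, mem_Icc]; exact ⟨⟨le_rfl, by omega⟩, hy 0 (by omega)⟩
  have hSne : S.Nonempty := ⟨1, h1S⟩
  set i := S.max' hSne with hi
  have hiS : i ∈ S := max'_mem S hSne
  rw [hS, mem_filter, mem_Icc] at hiS
  obtain ⟨⟨hi1, hin⟩, hpos⟩ := hiS
  -- `o(w 0, w (i+1), y) ≤ 0`
  have hnext : orient3 (w 0) (w (i + 1)) y ≤ 0 := by
    by_cases hlast : i + 1 = n - 1
    · have h := hy (n - 1) (by omega)
      rw [show n - 1 + 1 = n by omega, hw0] at h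
      rw [hlast]
      have : orient3 (w 0) (w (n - 1)) y = -orient3 (w (n - 1)) (w 0) y := by
        rw [orient3_swap_left]
      rw [this]; linarith
    · by_contra hgt
      rw [not_le] at hgt
      have hmem : i + 1 ∈ S := by
        rw [hS, mem_filter, mem_Icc]; exact ⟨⟨by omega, by omega⟩, hgt.le⟩
      have := le_max' S (i + 1) hmem
      rw [← hi] at this
      omega
  have hD := hcx 0 i (i + 1) (by omega) (by omega) (by omega)
  have hexp := orient3_expand (w 0) (w i) (w (i + 1)) y
  have h := congrArg (fun v => (orient3 (w 0) (w i) (w (i + 1)))⁻¹ • v) hexp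
  simp only [smul_add, smul_smul, inv_mul_cancel₀ hD.ne', one_smul] at h
  refine ⟨i, hi1, by omega, (orient3 (w 0) (w i) (w (i + 1)))⁻¹ * orient3 y (w i) (w (i + 1)),
    (orient3 (w 0) (w i) (w (i + 1)))⁻¹ * orient3 (w 0) y (w (i + 1)),
    (orient3 (w 0) (w i) (w (i + 1)))⁻¹ * orient3 (w 0) (w i) y, ?_, ?_, ?_, h⟩
  · apply mul_nonneg (inv_nonneg.2 hD.le)
    rw [orient3_cyclic]; exact hy i (by omega)
  · apply mul_nonneg (inv_nonneg.2 hD.le)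
    rw [orient3_swap_right]; linarith
  · exact mul_nonneg (inv_nonneg.2 hD.le) hpos

omit hper in
/-- A point of the closed cone on the strictly positive side of `ν` forces a vertex with
`⟪w i, ν⟫ > 0`. -/
theorem exists_inner_pos_vertex (hw0 : w n = w 0) {y : EuclideanSpace ℝ (Fin 3)}
    (ν : EuclideanSpace ℝ (Fin 3))
    (hy : ∀ i, i < n → 0 ≤ orient3 (w i) (w (i + 1)) y) (hyν : 0 < ⟪y, ν⟫) :
    ∃ i, i < n ∧ 0 < ⟪w i, ν⟫ := by
  obtain ⟨i, hi1, hin, a, b, c, ha, hb, hc, hyeq⟩ := exists_fan_triangle hn hcx hw0 hy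
  by_contra hall
  simp only [not_exists, not_and, not_lt] at hall
  have h0 := hall 0 (by omega)
  have hi := hall i (by omega)
  have hi' := hall (i + 1) (by omega)
  rw [hyeq, inner_add_left, inner_add_left, real_inner_smul_left, real_inner_smul_left,
    real_inner_smul_left] at hyν
  nlinarith [mul_nonpos_of_nonneg_of_nonpos ha h0, mul_nonpos_of_nonneg_of_nonpos hb hi,
    mul_nonpos_of_nonneg_of_nonpos hc hi']

omit hper in
/-- A point of the closed cone ON the circle `ν⊥`, when all vertices are on the closed positive
side, is a nonnegative combination of two CONSECUTIVE vertices lying on the circle: more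
precisely it lies in the closed cone of an edge `(w i, w (i+1))` with `1 ≤ i`, `i + 1 ≤ n − 1`,
and only endpoints on the circle carry weight — provided the base vertex `w 0` is strictly
positive. -/
theorem exists_edge_of_inner_zero (hw0 : w n = w 0) {y : EuclideanSpace ℝ (Fin 3)}
    (ν : EuclideanSpace ℝ (Fin 3))
    (hy : ∀ i, i < n → 0 ≤ orient3 (w i) (w (i + 1)) y) (hν : ∀ i, i < n → 0 ≤ ⟪w i, ν⟫)
    (h0 : 0 < ⟪w 0, ν⟫) (hyν : ⟪y, ν⟫ = 0) :
    ∃ i, 1 ≤ i ∧ i + 2 ≤ n ∧ ∃ b c : ℝ, 0 ≤ b ∧ 0 ≤ c ∧ y = b • w i + c • w (i + 1) ∧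
      (b = 0 ∨ ⟪w i, ν⟫ = 0) ∧ (c = 0 ∨ ⟪w (i + 1), ν⟫ = 0) := by
  obtain ⟨i, hi1, hin, a, b, c, ha, hb, hc, hyeq⟩ := exists_fan_triangle hn hcx hw0 hy
  have hsum : a * ⟪w 0, ν⟫ + b * ⟪w i, ν⟫ + c * ⟪w (i + 1), ν⟫ = 0 := by
    have := hyν
    rw [hyeq, inner_add_left, inner_add_left, real_inner_smul_left, real_inner_smul_left,
      real_inner_smul_left] at this
    exact this
  have hi := hν i (by omega)
  have hi' := hν (i + 1) (by omega)
  have hta : a * ⟪w 0, ν⟫ = 0 := by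
    nlinarith [mul_nonneg ha h0.le, mul_nonneg hb hi, mul_nonneg hc hi']
  have ha0 : a = 0 := by
    rcases mul_eq_zero.1 hta with h | h
    · exact h
    · exact absurd h h0.ne'
  have htb : b * ⟪w i, ν⟫ = 0 := by
    nlinarith [mul_nonneg ha h0.le, mul_nonneg hb hi, mul_nonneg hc hi']
  have htc : c * ⟪w (i + 1), ν⟫ = 0 := by
    nlinarith [mul_nonneg ha h0.le, mul_nonneg hb hi, mul_nonneg hc hi']
  refine ⟨i, hi1, hin, b, c, hb, hc, ?_, mul_eq_zero.1 htb, mul_eq_zero.1 htc⟩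
  rw [hyeq, ha0, zero_smul, zero_add]

omit hn hper in
/-- **Three vertices never lie on one great circle**: if `⟪w i, ν⟫ = ⟪w j, ν⟫ = ⟪w l, ν⟫ = 0`
for `i < j < l < i + n` then `ν = 0`. -/
theorem eq_zero_of_three_on_circle {ν : EuclideanSpace ℝ (Fin 3)} {i j l : ℕ} (hij : i < j)
    (hjl : j < l)
    (hli : l < i + n) (hi : ⟪w i, ν⟫ = 0) (hj : ⟪w j, ν⟫ = 0) (hl : ⟪w l, ν⟫ = 0) : ν = 0 := by
  have hD := hcx i j l hij hjl hli
  have hexp := orient3_expand (w i) (w j) (w l) ν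
  have h := congrArg (fun v => ⟪v, ν⟫) hexp
  simp only [inner_add_left, real_inner_smul_left, hi, hj, hl, mul_zero, add_zero] at h
  have hνν : ⟪ν, ν⟫ = 0 := by
    rcases mul_eq_zero.1 h with h1 | h1
    · exact absurd h1 hD.ne'
    · exact h1
  exact inner_self_eq_zero.1 hνν

end Polygon

/-! ## Part D. Extracting the sign block from unimodality -/

section Block

variable {n : ℕ} {w : ℕ → EuclideanSpace ℝ (Fin 3)} (hn : 3 ≤ n) (hper : ∀ i, w (i + n) = w i)
  (hcx : ∀ i j k, i < j → j < k → k < i + n → 0 < orient3 (w i) (w j) (w k))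
include hn hper hcx

/-- **The sign block.** If some vertex is strictly negative and some vertex strictly positive
for `⟪·, ν⟫`, then after a rotation `r` of the indices the strictly positive vertices are exactly
an initial block `r, …, r + k − 1` (`1 ≤ k < n`), the others are `≤ 0`, and the block of
non-positive vertices contains a strictly negative one. -/
theorem exists_sign_block (ν : EuclideanSpace ℝ (Fin 3)) (hneg : ∃ i, i < n ∧ ⟪w i, ν⟫ < 0)
    (hposv : ∃ i, i < n ∧ 0 < ⟪w i, ν⟫) :
    ∃ r k, 1 ≤ k ∧ k < n ∧ (∀ i, i < k → 0 < ⟪w (r + i), ν⟫) ∧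
      (∀ i, k ≤ i → i < n → ⟪w (r + i), ν⟫ ≤ 0) ∧ (∃ i, k ≤ i ∧ i < n ∧ ⟪w (r + i), ν⟫ < 0) := by
  classical
  obtain ⟨i₁, hi₁n, hi₁⟩ := hneg
  obtain ⟨p, hpn, hp⟩ := hposv
  -- a positive index in the window `[i₁, i₁ + n)`
  have hex : ∃ j, j < n ∧ 0 < ⟪w (i₁ + j), ν⟫ := by
    rcases Nat.lt_or_ge p i₁ with h | h
    · refine ⟨p + n - i₁, by omega, ?_⟩
      rw [show i₁ + (p + n - i₁) = p + n by omega, hper]; exact hp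
    · refine ⟨p - i₁, by omega, ?_⟩
      rw [show i₁ + (p - i₁) = p by omega]; exact hp
  -- the first positive index after `i₁`
  let jstar := Nat.find hex
  have hjspec := Nat.find_spec hex
  have hjmin : ∀ j, j < jstar → ¬ (j < n ∧ 0 < ⟪w (i₁ + j), ν⟫) := fun j hj => Nat.find_min hex hj
  have hj1 : 1 ≤ jstar := by
    by_contra h
    have h0 : jstar = 0 := by omega
    have := hjspec.2
    rw [show i₁ + jstar = i₁ by rw [h0, add_zero]] at this
    linarith
  set r := i₁ + jstar with hr
  have hrpos : 0 < ⟪w r, ν⟫ := hjspec.2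
  have hrprev : ⟪w (r + (n - 1)), ν⟫ ≤ 0 := by
    have h := hjmin (jstar - 1) (by omega)
    rw [not_and, not_lt] at h
    have := h (by omega)
    rwa [show r + (n - 1) = i₁ + (jstar - 1) + n by omega, hper]
  -- `k` = the first index `≥ 1` in the rotated cycle that is not strictly positive
  have hexk : ∃ i, 1 ≤ i ∧ ⟪w (r + i), ν⟫ ≤ 0 := ⟨n - 1, by omega, hrprev⟩
  let k := Nat.find hexk
  have hkspec := Nat.find_spec hexk
  have hkmin : ∀ i, i < k → ¬ (1 ≤ i ∧ ⟪w (r + i), ν⟫ ≤ 0) := fun i hi => Nat.find_min hexk hi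
  have hk1 : 1 ≤ k := hkspec.1
  have hkn : k ≤ n - 1 := by
    by_contra h
    exact hkmin (n - 1) (by omega) ⟨by omega, hrprev⟩
  have hblock : ∀ i, i < k → 0 < ⟪w (r + i), ν⟫ := by
    intro i hi
    rcases Nat.eq_zero_or_pos i with h0 | h0
    · rw [h0, add_zero]; exact hrpos
    · have := hkmin i hi
      rw [not_and, not_le] at this
      exact this h0
  refine ⟨r, k, hk1, by omega, hblock, ?_, ?_⟩
  · -- every later index is `≤ 0`, by unimodality
    intro i hki hin
    by_contra hgt
    rw [not_le] at hgt
    rcases eq_or_lt_of_le hki with heq | hlt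
    · rw [← heq] at hgt; linarith [hkspec.2]
    rcases Nat.lt_or_ge i (n - 1) with h | h
    · exact not_alternating_signs hcx ν (a := r) (b := r + k) (c := r + i) (d := r + (n - 1))
        (by omega) (by omega) (by omega) (by omega) hrpos hkspec.2 hgt hrprev
    · have : i = n - 1 := by omega
      rw [this] at hgt
      linarith
  · -- the strictly negative vertex `i₁` sits at rotated index `n − jstar`
    have hjn : jstar < n := hjspec.1
    refine ⟨n - jstar, ?_, by omega, ?_⟩
    · by_contra h
      rw [not_le] at h
      have := hblock (n - jstar) h
      rw [show r + (n - jstar) = i₁ + n by omega, hper] at this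
      linarith
    · rw [show r + (n - jstar) = i₁ + n by omega, hper]; exact hi₁

end Block

/-! ## Part E. Rotating the indices -/

section Shift

variable {n : ℕ} {w : ℕ → EuclideanSpace ℝ (Fin 3)} (r : ℕ)

/-- Periodicity is preserved by a rotation of the indices. -/
theorem shift_periodic (hper : ∀ i, w (i + n) = w i) : ∀ i, w (i + n + r) = w (i + r) := by
  intro i; rw [show i + n + r = (i + r) + n by ring, hper]

/-- Window convex position is preserved by a rotation of the indices. -/
theorem shift_convex (hcx : ∀ i j k, i < j → j < k → k < i + n → 0 < orient3 (w i) (w j) (w k)) :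
    ∀ i j k, i < j → j < k → k < i + n → 0 < orient3 (w (i + r)) (w (j + r)) (w (k + r)) :=
  fun i j k hij hjk hk => hcx (i + r) (j + r) (k + r) (by omega) (by omega) (by omega)

/-- A sum over one period is invariant under rotation. -/
theorem sum_period_shift (hper : ∀ i, w (i + n) = w i)
    (g : EuclideanSpace ℝ (Fin 3) → EuclideanSpace ℝ (Fin 3) → ℝ) :
    ∑ i ∈ range n, g (w (i + r)) (w (i + r + 1)) = ∑ i ∈ range n, g (w i) (w (i + 1)) := by
  induction r with
  | zero => simp
  | succ r ih =>
    rw [← ih]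
    set f : ℕ → ℝ := fun i => g (w (i + r)) (w (i + r + 1)) with hf
    have h1 := Finset.sum_range_succ' f n
    have h2 := Finset.sum_range_succ f n
    have hfn : f n = f 0 := by
      simp only [hf, zero_add]
      rw [show n + r = r + n by ring, hper, show r + n + 1 = (r + 1) + n by ring, hper]
    have hl : ∑ i ∈ range n, g (w (i + (r + 1))) (w (i + (r + 1) + 1)) =
        ∑ i ∈ range n, f (i + 1) := by
      apply Finset.sum_congr rfl
      intro i _
      simp only [hf]
      rw [show i + (r + 1) = i + 1 + r by ring]
    rw [hl]
    linarith

/-- Edge conditions over one period transfer to the rotated polygon. -/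
theorem shift_edges (hper : ∀ i, w (i + n) = w i) (hn : 1 ≤ n)
    {P : EuclideanSpace ℝ (Fin 3) → EuclideanSpace ℝ (Fin 3) → Prop}
    (h : ∀ i, i < n → P (w i) (w (i + 1))) : ∀ i, i < n → P (w (i + r)) (w (i + r + 1)) := by
  have hperk : ∀ i q, w (i + q * n) = w i := by
    intro i q
    induction q with
    | zero => simp
    | succ q ih => rw [Nat.succ_mul, ← add_assoc, hper, ih]
  intro i _
  have e1 : w (i + r) = w ((i + r) % n) := by
    conv_lhs => rw [← Nat.mod_add_div' (i + r) n, hperk]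
  have e2 : w (i + r + 1) = w ((i + r) % n + 1) := by
    conv_lhs => rw [show i + r + 1 = ((i + r) % n + 1) + (i + r) / n * n by
      have := Nat.mod_add_div' (i + r) n; omega, hperk]
  rw [e1, e2]
  exact h _ (Nat.mod_lt _ (by omega))

/-- Vertex conditions over one period transfer to the rotated polygon. -/
theorem shift_vertices (hper : ∀ i, w (i + n) = w i) (hn : 1 ≤ n)
    {P : EuclideanSpace ℝ (Fin 3) → Prop}
    (h : ∀ i, i < n → P (w i)) : ∀ i, i < n → P (w (i + r)) := by
  have := shift_edges r hper hn (P := fun a _ => P a) h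
  exact fun i hi => this i hi

end Shift


end Summit.Ventures.Crystal3D

end
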